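import Summits.QuantumFields.GaugeBoot.Rows.GLYZc2D4HTab
import HarnessLib

/-!
# Gauge-boot: kernel check of the raw `H` class table of the glyz-c2-4D problems, rows 121–140 (part 9/20)

Cell `pub-gaugeboot` (HOME `run/shared/lean/pub/pub-gaugeboot/`), seat lean1 (torus layer for rows C76–C87 = the certified
glyz-c2-4D windows: label set, raw blocks, class/witness tables, the reduction identity, per-β bindings).

HONEST FRAMING (page 1 of every file of this cell): certified bounds on lattice expectations at STATED coupling,
gauge group, dimension and torus size; NOT a mass gap, NOT a continuum limit, NOT a string tension, NOT large `N`.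
The venture is explicitly NOT Yang–Mills-summit-bearing (barriers `FixedCouplingUltralocality`,
`PerturbativeInvisibility`).

`hcanon_rows_<lo>_<hi> : ∀ i, lo ≤ i < hi → ∀ j ≥ i, GLYZc2D4.HCanonOK i j`, each range one closed computation (`decide +kernel`);
assembled in `GLYZc2D4Canon`.
-/

noncomputable section

open Literature.MathematicalPhysics.QuantumFieldTheory

namespace Summit.QuantumFields.GaugeBoot

namespace GLYZc2D4

set_option maxHeartbeats 0 in
/-- Rows `121 ≤ i < 125` of the `H` class table of the glyz-c2-4D problems canonicalise (1506 entries; kernel). -/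
theorem hcanon_rows_121_125 : ∀ i : Fin 499, 121 ≤ i.val → i.val < 125 → ∀ j : Fin 499, i.val ≤ j.val → GLYZc2D4.HCanonOK i j := by
  decide +kernel

set_option maxHeartbeats 0 in
/-- Rows `125 ≤ i < 129` of the `H` class table of the glyz-c2-4D problems canonicalise (1490 entries; kernel). -/
theorem hcanon_rows_125_129 : ∀ i : Fin 499, 125 ≤ i.val → i.val < 129 → ∀ j : Fin 499, i.val ≤ j.val → GLYZc2D4.HCanonOK i j := by
  decide +kernel

set_option maxHeartbeats 0 in
/-- Rows `129 ≤ i < 133` of the `H` class table of the glyz-c2-4D problems canonicalise (1474 entries; kernel). -/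
theorem hcanon_rows_129_133 : ∀ i : Fin 499, 129 ≤ i.val → i.val < 133 → ∀ j : Fin 499, i.val ≤ j.val → GLYZc2D4.HCanonOK i j := by
  decide +kernel

set_option maxHeartbeats 0 in
/-- Rows `133 ≤ i < 137` of the `H` class table of the glyz-c2-4D problems canonicalise (1458 entries; kernel). -/
theorem hcanon_rows_133_137 : ∀ i : Fin 499, 133 ≤ i.val → i.val < 137 → ∀ j : Fin 499, i.val ≤ j.val → GLYZc2D4.HCanonOK i j := by
  decide +kernel

set_option maxHeartbeats 0 in
/-- Rows `137 ≤ i < 141` of the `H` class table of the glyz-c2-4D problems canonicalise (1442 entries; kernel). -/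
theorem hcanon_rows_137_141 : ∀ i : Fin 499, 137 ≤ i.val → i.val < 141 → ∀ j : Fin 499, i.val ≤ j.val → GLYZc2D4.HCanonOK i j := by
  decide +kernel

end GLYZc2D4

end Summit.QuantumFields.GaugeBoot

end
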